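import Mathlib
import Literature.AlgebraicGeometry.HyperbolicPolynomials.HyperbolicityCone
import Literature.AlgebraicGeometry.HyperbolicPolynomials.Garding
import Literature.AlgebraicGeometry.HyperbolicPolynomials.SmoothBoundary

/-!
# `PermanentalConeHard` (stmt-ValiantsHypothesis-8654), line `birth` — stub `stub_gardingGradient`
(DICTIONARY: Gårding's dual-cone lemma)

Route `PermanentalCones` of `ValiantsHypothesis`, crux `PermanentalConeHard`. For a homogeneous
`P ∈ ℝ[s_1..s_n]` hyperbolic w.r.t. `e` with `P(e) > 0`, the gradient pairing
`gradForm P z x = ⟨∇P(z), x⟩ = coeff₁ (t ↦ P(z + t x))` is nonnegative for all `z, x` in the closed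
hyperbolicity cone `Λ₊(P, e) = hyperbolicityCone P e`; i.e. `∇P(z)` is a dual vector of the cone
(Gårding 1959). In the assembly `PermanentalConeHard_of` this supplies the hypothesis
"`ls k ≥ 0` on `K`" of the slack-matrix factorisation tool with `ls k := gradForm (P n) (zs k)`.

Proof.
* Interior points `z ∈ Λ₊₊(P, e)`: by the product form along lines through interior points
  (`linePoly_eq_C_mul_prodOneAdd`, Gårding's theorem), `P(z + t x) = P(z) ∏ᵢ (1 - rᵢ t)` over the
  real roots `rᵢ` of `t ↦ P(x + t z)`; hence `⟨∇P(z), x⟩ = P(z) Σᵢ (-rᵢ)` (`coeff_one_prodOneAdd`).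
  Here `P(z) > 0` (`eval_pos_of_mem`), and every root `rᵢ` is `≤ 0` because
  `x ∈ Λ₊(P, e) = Λ₊(P, z)` (independence of the direction, `hyperbolicityCone_eq_of_mem`) and
  `mem_hyperbolicityCone_iff_forall_root_nonpos`.
* Closure: `Λ₊(P, e)` is the closure of `Λ₊₊(P, e)` (`hyperbolicityCone_eq_closure`) and
  `z ↦ ⟨∇P(z), x⟩ = coeff₁ (linePoly P z x)` is continuous (`continuous_coeff_linePoly`), so the
  closed set `{z | 0 ≤ ⟨∇P(z), x⟩}` containing `Λ₊₊` contains `Λ₊`.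

Homogeneity is necessary (`P = s + 1`, `n = 1`: `Λ₊ = [-1, ∞)`, `∇P = 1`, `x = -1`).

References: L. Gårding, *An inequality for hyperbolic polynomials*, J. Math. Mech. 8 (1959)
957–965, Thm 2; J. Renegar, *Hyperbolic programs, and their derivative relaxations*, Found.
Comput. Math. 6 (2006) 59–79, §2–3.
-/

set_option linter.dupNamespace false

noncomputable section

namespace Summit.ValiantsHypothesis.ValiantsHypothesis.Theorems.PermanentalConesPermanentalConeHard

open MvPolynomial
open scoped BigOperators Polynomial
open Literature.AlgebraicGeometry.HyperbolicPolynomials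

/-- **Interior case of Gårding's dual-cone lemma.** For a form `P` hyperbolic w.r.t. `e` with
`P(e) > 0`, `z` in the open cone `Λ₊₊(P, e)` and `x` in the closed cone `Λ₊(P, e)`:
`⟨∇P(z), x⟩ = P(z) Σᵢ (-rᵢ) ≥ 0`, where the `rᵢ ≤ 0` are the roots of `t ↦ P(x + t z)`. -/
theorem gradForm_nonneg_of_mem_openHyperbolicityCone {n d : ℕ} {P : MvPolynomial (Fin n) ℝ}
    {e : Fin n → ℝ} (hP : P.IsHomogeneous d) (he : IsHyperbolic P e)
    (hpos : 0 < MvPolynomial.eval e P) {z : Fin n → ℝ} (hz : z ∈ openHyperbolicityCone P e)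
    {x : Fin n → ℝ} (hx : x ∈ hyperbolicityCone P e) : 0 ≤ gradForm P z x := by
  rw [gradForm_apply, linePoly_eq_C_mul_prodOneAdd hP he hz x, Polynomial.coeff_C_mul,
    coeff_one_prodOneAdd]
  refine mul_nonneg (eval_pos_of_mem hP he hpos hz).le (Multiset.sum_nonneg fun s hs => ?_)
  obtain ⟨r, hr, rfl⟩ := Multiset.mem_map.1 hs
  have hroot := (Polynomial.mem_roots
    (linePoly_ne_zero hP (eval_ne_zero_of_mem_openHyperbolicityCone hz) x)).1 hr
  rw [Polynomial.IsRoot.def, eval_linePoly] at hroot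
  have hx' : x ∈ hyperbolicityCone P z := by rwa [hyperbolicityCone_eq_of_mem hP he hz]
  have hr0 : r ≤ 0 := (mem_hyperbolicityCone_iff_forall_root_nonpos P z x).1 hx' r hroot
  simpa using hr0

/-- **DICTIONARY (Gårding's dual-cone lemma).**  For a homogeneous `P ∈ ℝ[s_1..s_n]` hyperbolic
w.r.t. `e` with `P(e) > 0`, the gradient pairing `gradForm P z x = ⟨∇P(z), x⟩` is nonnegative for
all `z, x` in the closed hyperbolicity cone `Λ₊(P, e)` (interior case
`gradForm_nonneg_of_mem_openHyperbolicityCone`, then `Λ₊ = closure Λ₊₊` and continuity of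
`z ↦ ⟨∇P(z), x⟩`). -/
theorem stub_gardingGradient :
    ∀ (n d : ℕ) (P : MvPolynomial (Fin n) ℝ) (e : Fin n → ℝ), P.IsHomogeneous d →
      IsHyperbolic P e → 0 < MvPolynomial.eval e P →
      ∀ z ∈ hyperbolicityCone P e, ∀ x ∈ hyperbolicityCone P e, 0 ≤ gradForm P z x := by
  intro n d P e hP he hpos z hz x hx
  have hcont : Continuous fun w : Fin n → ℝ => gradForm P w x := by
    simp_rw [gradForm_apply]
    exact continuous_coeff_linePoly P x 1
  have hclosed : IsClosed {w : Fin n → ℝ | 0 ≤ gradForm P w x} :=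
    isClosed_le continuous_const hcont
  have hsub : openHyperbolicityCone P e ⊆ {w : Fin n → ℝ | 0 ≤ gradForm P w x} :=
    fun w hw => gradForm_nonneg_of_mem_openHyperbolicityCone hP he hpos hw hx
  have hzc : z ∈ closure (openHyperbolicityCone P e) := by
    rw [← hyperbolicityCone_eq_closure hP he]
    exact hz
  exact closure_minimal hsub hclosed hzc

end Summit.ValiantsHypothesis.ValiantsHypothesis.Theorems.PermanentalConesPermanentalConeHard

end
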